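import Summits.QuantumFields.YangMills.Theorems.SwapVirialDeficitZeroModeSigmaFourSmallBallRate
import Summits.QuantumFields.YangMills.Theorems.SwapVirialDeficitLaplaceAbelianLimit
import Summits.QuantumFields.YangMills.Theorems.SwapVirialDeficitTauberSandwichRpow
import HarnessLib

/-!
# Exact zero-mode rung Z5 in LAPLACE form WITH A RATE: `|β^{7/2}·∫e^{−β·G_σ} dHaar⁴ − sigmaV·Γ(9/2)| ≤ K·β^{−θ}`
# (LEAD ym-line-sfw-p2 g93 «sum ↔ Laplace form of the zero-mode block»; free-hands support of ⟨stmt-QuantumFields-24197⟩)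

The Abelian glue ✓`laplace_abelian_rate` (w2 g56) turns the small-ball POWER RATE ✓`sigmaBall_smallBall_rate` (parts I–VII, w2 g56 + w3 g63) of the
σ-twisted four-leader event `E_σ(t) = {G_σ ≤ t²}` (`G_σ = sigmaMaxSq`, ✓`setOf_sigmaMaxSq_le`) into the Laplace-side statement with a rate:
★★★ `laplace_sigmaTwisted_rate` — `∃ K θ > 0, ∀ β ≥ 1, |β^{7/2}·∫ e^{−β·sigmaMaxSq} dHaar⁴ − sigmaV·Γ(7/2 + 1)| ≤ K·β^{−θ}` (`θ = 1/64`).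
HONEST LABEL: finite-dimensional real analysis (plan-level zero-mode rung of a DRAFT line «sharp-sigma»); NOT the fixed-`L` sharp law, NOT ⟨24197⟩; the
Yang–Mills mass gap is NOT proved; no summit is proved by a line.  Width seat ym-line-sfw-p2-w2 g56 (cell ym-idea-1, free hands; own crux ⟨22884⟩
blocked-on ⟨19935⟩), `--supports stmt-QuantumFields-24197`.  THEOREMS ONLY, standard axioms, 0 `sorry`.
References: [cite: GonzalezarroyoAltes1988]; [cite: Vanbaal2001]; [cite: Luscher1983, §2]; [folklore].
-/

set_option autoImplicit false

noncomputable section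

open MeasureTheory Set Real Filter
open scoped ENNReal Topology
open Quaternion Literature.MathematicalPhysics.QuantumLattice
open scoped Quaternion
open Literature.MathematicalPhysics.QuantumFieldTheory (haarProbability)
open Summit.QuantumFields.YangMills.Theorems.SwapVirialDeficit.ZeroModeSigma (sigmaBall sigmaV sigmaV_pos sigmaBall_smallBall_rate
  sigmaBall_smallBall_relative)
open Summit.QuantumFields.YangMills.Theorems.SwapVirialDeficit.SharpSigma (tauber_sandwich_rpow)

namespace Summit.QuantumFields.YangMills.Theorems.SwapVirialDeficit.Abelian

/-- The small-ball rate in CDF form for `G_σ = sigmaMaxSq`: `|Haar⁴{G_σ ≤ s} − sigmaV·s^{7/2}| ≤ K·s^{7/2 + θ/2}` on `(0, 1]`. [folklore] -/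
theorem abs_haar_sigmaMaxSq_le_sub_le {K θ : ℝ}
    (hrate : ∀ t : ℝ, 0 < t → t ≤ 1 →
      |((Measure.pi fun _ : Fin 4 => haarProbability (Matrix.specialUnitaryGroup (Fin 2) ℂ)) (sigmaBall t)).toReal / t ^ 7 - sigmaV| ≤ K * t ^ θ)
    {s : ℝ} (hs : 0 < s) (hs1 : s ≤ 1) :
    |((Measure.pi fun _ : Fin 4 => haarProbability (Matrix.specialUnitaryGroup (Fin 2) ℂ)) {C | sigmaMaxSq C ≤ s}).toReal -
        sigmaV * s ^ (7/2 : ℝ)| ≤ max K 0 * s ^ ((7/2 : ℝ) + θ / 2) := by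
  rw [setOf_sigmaMaxSq_le hs.le]
  have hτ : 0 < Real.sqrt s := Real.sqrt_pos.2 hs
  have hτ1 : Real.sqrt s ≤ 1 := by rw [← Real.sqrt_one]; exact Real.sqrt_le_sqrt hs1
  have h := hrate (Real.sqrt s) hτ hτ1
  have e7 : Real.sqrt s ^ 7 = s ^ (7/2 : ℝ) := by
    rw [Real.sqrt_eq_rpow, ← Real.rpow_natCast, ← Real.rpow_mul hs.le]; norm_num
  have eθ : Real.sqrt s ^ θ = s ^ (θ / 2) := by
    rw [Real.sqrt_eq_rpow, ← Real.rpow_mul hs.le]; ring_nf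
  rw [e7, eθ] at h
  have hpos : 0 < s ^ (7/2 : ℝ) := Real.rpow_pos_of_pos hs _
  set m := ((Measure.pi fun _ : Fin 4 => haarProbability (Matrix.specialUnitaryGroup (Fin 2) ℂ)) (sigmaBall (Real.sqrt s))).toReal with hm
  have e : m - sigmaV * s ^ (7/2 : ℝ) = s ^ (7/2 : ℝ) * (m / s ^ (7/2 : ℝ) - sigmaV) := by
    field_simp
  rw [e, abs_mul, abs_of_pos hpos, Real.rpow_add hs]
  calc s ^ (7/2 : ℝ) * |m / s ^ (7/2 : ℝ) - sigmaV| ≤ s ^ (7/2 : ℝ) * (K * s ^ (θ / 2)) := by gcongr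
    _ ≤ s ^ (7/2 : ℝ) * (max K 0 * s ^ (θ / 2)) := by gcongr; exact le_max_left _ _
    _ = max K 0 * (s ^ (7/2 : ℝ) * s ^ (θ / 2)) := by ring

/-- ★★★ **THE σ-TWISTED ZERO-MODE BLOCK IN LAPLACE FORM, WITH A RATE**: there are `K` and `θ > 0` with
`|β^{7/2}·∫ e^{−β·sigmaMaxSq} dHaar⁴ − sigmaV·Γ(7/2 + 1)| ≤ K·β^{−θ}` for all `β ≥ 1` (`sigmaV > 0` the canonical small-ball constant of
✓`sigmaBall_smallBall_limit_eq`).  Abelian glue ✓`laplace_abelian_rate` applied to ✓`sigmaBall_smallBall_rate`. [cite: GonzalezarroyoAltes1988] [cite: Vanbaal2001] -/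
theorem laplace_sigmaTwisted_rate :
    ∃ K θ : ℝ, 0 < θ ∧ ∀ β : ℝ, 1 ≤ β →
      |β ^ (7/2 : ℝ) * ∫ C, Real.exp (-(β * sigmaMaxSq C)) ∂(Measure.pi fun _ : Fin 4 => haarProbability (Matrix.specialUnitaryGroup (Fin 2) ℂ)) -
          sigmaV * Real.Gamma ((7/2 : ℝ) + 1)| ≤ K * β ^ (-θ) := by
  obtain ⟨K, θ, hθ, hrate⟩ := sigmaBall_smallBall_rate
  set μ : Measure (Fin 4 → Matrix.specialUnitaryGroup (Fin 2) ℂ) := Measure.pi fun _ : Fin 4 => haarProbability (Matrix.specialUnitaryGroup (Fin 2) ℂ)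
    with hμ
  have hm : ∀ s : ℝ, 0 < s → s ≤ 1 → |(μ {C | sigmaMaxSq C ≤ s}).toReal - sigmaV * s ^ (7/2 : ℝ)| ≤ max K 0 * s ^ ((7/2 : ℝ) + θ / 2) :=
    fun s hs hs1 => abs_haar_sigmaMaxSq_le_sub_le hrate hs hs1
  refine ⟨(max K 0 + (μ univ).toReal + sigmaV) * Real.Gamma ((7/2 : ℝ) + θ / 2 + 1), θ / 2, by positivity, fun β hβ => ?_⟩
  exact laplace_abelian_rate μ measurable_sigmaMaxSq (fun C => by unfold sigmaMaxSq; positivity) (by norm_num) (by positivity) sigmaV_pos.le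
    (le_max_right _ _) hm hβ

/-! ## The «sharp-sigma» Tauberian shape at the zero-mode block: `log ∫ e^{−β·sigmaMax} dHaar⁴ = log sigmaV + log 7! − 7 log β + O(β^{−θ})` -/

/-- `{sigmaMax ≤ t} = E_σ(t)`. [folklore] -/
theorem setOf_sigmaMax_le (t : ℝ) : {C | sigmaMax C ≤ t} = sigmaBall t := by
  ext C
  simp only [mem_setOf_eq, sigmaBall]
  rw [sigmaMax, max_le_iff, ciSup_le_iff (Finite.bddAbove_range _), ciSup_le_iff (Finite.bddAbove_range _)]
  constructor
  · rintro ⟨h1, h2⟩; exact ⟨fun μ ν => h1 (μ, ν), h2⟩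
  · rintro ⟨h1, h2⟩; exact ⟨fun p => h1 p.1 p.2, h2⟩

/-- ★★★ **THE ZERO-MODE BLOCK MEETS THE CARD'S TAUBERIAN SANDWICH**: with `κ ≥ 0`, `0 < θ ≤ 1` from ✓`sigmaBall_smallBall_relative`
(`hvol` at `N = 7`, `v = sigmaV`, `t₀ = 1`), ✓`SharpSigma.tauber_sandwich_rpow` gives, for all large `β`,
`|log ∫ e^{−β·sigmaMax} dHaar⁴ − (log sigmaV + log 7! − 7·log β)| ≤ 2κ·9·β^{−θ} + 2/β`. [cite: GonzalezarroyoAltes1988] [cite: Vanbaal2001] -/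
theorem log_laplace_sigmaMax_asymp :
    ∃ κ θ : ℝ, 0 ≤ κ ∧ 0 < θ ∧ ∀ᶠ β : ℝ in atTop,
      |Real.log (∫ C, Real.exp (-(β * sigmaMax C)) ∂(Measure.pi fun _ : Fin 4 => haarProbability (Matrix.specialUnitaryGroup (Fin 2) ℂ))) -
          (Real.log sigmaV + Real.log ((Nat.factorial 7 : ℕ) : ℝ) - ((7 : ℕ) : ℝ) * Real.log β)| ≤
        2 * κ * (((7 : ℕ) : ℝ) + 2) * β ^ (-θ) + 2 / β := by
  obtain ⟨κ₀, θ₀, hθ₀, hrel⟩ := sigmaBall_smallBall_relative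
  set μ4 : Measure (Fin 4 → Matrix.specialUnitaryGroup (Fin 2) ℂ) := Measure.pi fun _ : Fin 4 => haarProbability (Matrix.specialUnitaryGroup (Fin 2) ℂ)
    with hμ4
  haveI : IsProbabilityMeasure μ4 := by rw [hμ4]; infer_instance
  have hκ : 0 ≤ max κ₀ 0 := le_max_right _ _
  have hθ : 0 < min θ₀ 1 := lt_min hθ₀ one_pos
  have hθ1 : min θ₀ 1 ≤ 1 := min_le_right _ _
  have hvol : ∀ t : ℝ, 0 < t → t ≤ 1 → |μ4.real {C | sigmaMax C ≤ t} / (sigmaV * t ^ 7) - 1| ≤ max κ₀ 0 * t ^ (min θ₀ 1) := by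
    intro t ht ht1
    rw [setOf_sigmaMax_le, measureReal_def]
    have h := hrel t ht ht1
    have hmono : t ^ θ₀ ≤ t ^ (min θ₀ 1) := Real.rpow_le_rpow_of_exponent_ge ht ht1 (min_le_left _ _)
    have h0 : 0 ≤ t ^ θ₀ := by positivity
    calc _ ≤ κ₀ * t ^ θ₀ := h
      _ ≤ max κ₀ 0 * t ^ θ₀ := by gcongr; exact le_max_left _ _
      _ ≤ max κ₀ 0 * t ^ (min θ₀ 1) := by gcongr
  -- the three eventual side conditions of the sandwich
  have e1 : ∀ᶠ β : ℝ in atTop, 4 ≤ β := eventually_ge_atTop 4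
  have e2 : ∀ᶠ β : ℝ in atTop, max κ₀ 0 * (((7 : ℕ) : ℝ) + 2) * β ^ (-(min θ₀ 1)) ≤ 1 / 4 := by
    have h := (tendsto_rpow_neg_atTop hθ).const_mul (max κ₀ 0 * (((7 : ℕ) : ℝ) + 2))
    rw [mul_zero] at h
    filter_upwards [h.eventually (Iic_mem_nhds (by norm_num : (0:ℝ) < 1 / 4))] with β hβ
    simpa only [mem_Iic, mul_assoc] using hβ
  have e3 : ∀ᶠ β : ℝ in atTop, 64 * (((7 : ℕ) : ℝ) + 2) ^ 2 * (1 + |Real.log sigmaV| + |Real.log 1| + Real.log β) ≤ β * 1 := by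
    have hc0 : (0:ℝ) < 1 / (2 * (64 * 81)) := by norm_num
    filter_upwards [Real.isLittleO_log_id_atTop.def hc0, eventually_ge_atTop (2 * (64 * 81) * (1 + |Real.log sigmaV|)),
      eventually_ge_atTop (1:ℝ)] with β hlog hβ hβ1
    simp only [id_eq, Real.norm_eq_abs] at hlog
    rw [abs_of_nonneg (Real.log_nonneg hβ1), abs_of_pos (by linarith : (0:ℝ) < β)] at hlog
    rw [Real.log_one, abs_zero, add_zero]
    have habs : 0 ≤ |Real.log sigmaV| := abs_nonneg _
    push_cast
    nlinarith
  refine ⟨max κ₀ 0, min θ₀ 1, hκ, hθ, ?_⟩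
  filter_upwards [e1, e2, e3] with β h4 hκβ hwin
  have h := tauber_sandwich_rpow μ4 sigmaMax 7 sigmaV (max κ₀ 0) (min θ₀ 1) 1 measurable_sigmaMax sigmaMax_nonneg sigmaV_pos one_pos
    hκ hθ hθ1 hvol h4 hκβ hwin
  rw [hμ4] at h
  exact h

end Summit.QuantumFields.YangMills.Theorems.SwapVirialDeficit.Abelian

end
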